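import Literature.Geometry.Symplectic.BoundaryContactomorphism
import Literature.Topology.FourManifolds.Gluing
import HarnessLib

/-!
# The seam of a Stein bisection: a contactomorphic diffeomorphism of the abstract boundaries,
# along which the ambient manifold is glued

Topic `Literature/Geometry/Symplectic`; companion of `BoundaryContactomorphism.lean`
(`IsContacto J₁ J₂ b₁ b₂ ψ`: `dψ` carries the complex tangencies `ξ_{J₁}` of `∂W₁` onto those of
`∂W₂`, read on boundary data) and of `Literature/Topology/FourManifolds/Gluing.lean`
(`IsBoundaryGluing bM bN φ IP P`: *`P = M ∪_φ N`*).  Everything here is PROVED folklore; it is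
the Literature-side copy of the Summits-side stub `LegendrianRKnotRigidity.stub_seam`
(`Theorems/ConvexBisectionContractibleTwistedDoubleStandardStubSeam.lean`), which a Literature
file cannot import, plus the observation that the bisected manifold is the gluing along the seam.

**Setting.**  Two compact Stein domains `(W₁, J₁)`, `(W₂, J₂)` (tree `SteinStructure`, model
`𝓡∂ 4`) smoothly embedded by `e₁`, `e₂` in a `4`-manifold `X` so that the images meet exactly
along the images of BOTH boundaries, `range e₁ ∩ range e₂ = e₁ '' ∂W₁ = e₂ '' ∂W₂`, with the
pushed-forward complex tangencies `deᵢ (ξ_{Jᵢ})` equal at common points — the bisection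
hypothesis of the cruxes `ConvexBisection.AcyclicBisectionRigidity` /
`ContractibleTwistedDoubleStandard` of the SPC4 route ConvexBisection.  For boundary data `b₁`,
`b₂` the **seam map** `ψ = incl₂⁻¹ ∘ e₂⁻¹ ∘ e₁ ∘ incl₁ : b₁.carrier → b₂.carrier` is

* `exists_seamDiffeomorph_isContacto` — a diffeomorphism intertwining the embeddings
  (`e₂ ∘ incl₂ ∘ ψ = e₁ ∘ incl₁`) and a contactomorphism: set-theoretically forced by injectivity
  of `e₂ ∘ incl₂`; smooth in both directions because a continuous map into the source of an
  immersion is `C^∞` iff its composite with the immersion is (Mathlib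
  `ContMDiff.iff_comp_isImmersion`; Lee 2013, Thm. 5.29 — the uniqueness of the smooth structure
  of the embedded submanifold `e₁(∂W₁) = e₂(∂W₂)`, Lee 2013, Thm. 5.31); contact by the chain rule
  and injectivity of `de₁`, `de₂` (Geiges 2008, §2.1);
* `isBoundaryGluing_of_seam` — if moreover the images cover `X`, then `X = W₁ ∪_ψ W₂`.

## References

* J. M. Lee, *Introduction to Smooth Manifolds*, 2nd ed. (2013), Thm. 5.29, Thm. 5.31.
  [LeeSmoothManifolds2013]
* H. Geiges, *An Introduction to Contact Topology* (2008), §2.1, Def. 2.1.5. [Geiges2008]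
* M. W. Hirsch, *Differential Topology* (1976), §8.2. [HirschDT1976]
-/

noncomputable section

open scoped Manifold ContDiff Topology
open Set Function Literature.Topology.FourManifolds

namespace Literature.Geometry.Symplectic

/-! ### Smoothness through immersions; seam points -/

section Seam

variable {X : Type*} {W : Type*} [TopologicalSpace W] [ChartedSpace (EuclideanHalfSpace 4) W]

/-- **Smoothness of a map read through two immersions.**  If `e : W → X` is a smooth embedding,
`b` a boundary datum of `W`, and `ψ : N → b.carrier` is any map such that `e ∘ b.incl ∘ ψ = f` is
`C^∞`, then `ψ` is `C^∞` (`e ∘ b.incl` is a topological embedding, so `ψ` is continuous, and a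
continuous map into the source of an immersion is smooth iff its composite with the immersion is:
Mathlib `ContMDiff.iff_comp_isImmersion`, twice).  Lee 2013, Thm. 5.29 / Cor. 5.30.
(Adapted from the Summits-side `LegendrianRKnotRigidity.stub_seam`.) [folklore] -/
private theorem contMDiff_of_comp_incl_eq [TopologicalSpace X]
    [ChartedSpace (EuclideanSpace ℝ (Fin 4)) X]
    {N : Type*} [TopologicalSpace N] [ChartedSpace (EuclideanSpace ℝ (Fin 3)) N] {e : W → X}
    (he : Manifold.IsSmoothEmbedding (𝓡∂ 4) (𝓡 4) ∞ e) (b : BoundaryData (𝓡∂ 4) W (𝓡 3))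
    {ψ : N → b.carrier} {f : N → X} (hf : ContMDiff (𝓡 3) (𝓡 4) ∞ f)
    (h : ∀ z, e (b.incl (ψ z)) = f z) : ContMDiff (𝓡 3) (𝓡 3) ∞ ψ := by
  have hcomp : (e ∘ b.incl) ∘ ψ = f := funext h
  have hcomp' : e ∘ (b.incl ∘ ψ) = f := funext h
  have hemb : Topology.IsEmbedding (e ∘ b.incl) :=
    he.isEmbedding.comp b.isSmoothEmbedding.isEmbedding
  have hcont : Continuous ψ := by
    rw [hemb.continuous_iff, hcomp]
    exact hf.continuous
  rw [ContMDiff.iff_comp_isImmersion b.isSmoothEmbedding.isImmersion]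
  refine ⟨hcont, ?_⟩
  rw [ContMDiff.iff_comp_isImmersion he.isImmersion, hcomp']
  exact ⟨b.continuous_incl.comp hcont, hf⟩

/-- **Seam points come from the abstract boundary of the other half.**  If the images of
`e : W → X` and `e' : W' → X` meet exactly in `e '' ∂W` and exactly in `e' '' ∂W'`, then for
boundary data `b`, `b'` every point `e (b.incl z)` is of the form `e' (b'.incl w)`. [folklore] -/
private theorem exists_incl_eq_of_seam {W' : Type*} [TopologicalSpace W']
    [ChartedSpace (EuclideanHalfSpace 4) W'] {e : W → X} {e' : W' → X}
    (hI : range e ∩ range e' = e '' (𝓡∂ 4).boundary W)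
    (hI' : range e ∩ range e' = e' '' (𝓡∂ 4).boundary W')
    (b : BoundaryData (𝓡∂ 4) W (𝓡 3)) (b' : BoundaryData (𝓡∂ 4) W' (𝓡 3)) (z : b.carrier) :
    ∃ w : b'.carrier, e' (b'.incl w) = e (b.incl z) := by
  have hmem : e (b.incl z) ∈ range e ∩ range e' := by
    rw [hI]
    exact ⟨b.incl z, b.incl_mem_boundary z, rfl⟩
  rw [hI'] at hmem
  obtain ⟨w', hw', hw'e⟩ := hmem
  rw [← b'.range_incl] at hw'
  obtain ⟨w, rfl⟩ := hw'
  exact ⟨w, hw'e⟩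

end Seam

section Contacto

universe u

variable {X : Type*} [TopologicalSpace X] [ChartedSpace (EuclideanSpace ℝ (Fin 4)) X]
  [IsManifold (𝓡 4) ∞ X]
  {W₁ : Type u} [TopologicalSpace W₁] [ChartedSpace (EuclideanHalfSpace 4) W₁]
  [IsManifold (𝓡∂ 4) ∞ W₁] [CompactSpace W₁]
  {W₂ : Type u} [TopologicalSpace W₂] [ChartedSpace (EuclideanHalfSpace 4) W₂]
  [IsManifold (𝓡∂ 4) ∞ W₂] [CompactSpace W₂]

/-- **The seam map is a contactomorphism.**  If `e₂ ∘ incl₂ ∘ ψ = e₁ ∘ incl₁` with `ψ` smooth and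
the pushed-forward complex tangencies agree at common points, then `ψ` carries `d(incl₁)⁻¹ ξ₁` onto
`d(incl₂)⁻¹ ξ₂`: chain rule, the matching `de₁ ξ₁ = de₂ ξ₂` at `(incl₁ z, incl₂ (ψ z))`, and
injectivity of `de₁`, `de₂` (immersions).  Geiges 2008, §2.1.  (Adapted from the Summits-side
`LegendrianRKnotRigidity.stub_seam`.) [cite: Geiges2008, Def. 2.1.5] -/
private theorem isContacto_of_seam (J₁ : SteinStructure W₁) (J₂ : SteinStructure W₂)
    {e₁ : W₁ → X} {e₂ : W₂ → X}
    (h₁ : Manifold.IsSmoothEmbedding (𝓡∂ 4) (𝓡 4) ∞ e₁)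
    (h₂ : Manifold.IsSmoothEmbedding (𝓡∂ 4) (𝓡 4) ∞ e₂)
    (hC : ∀ w₁ w₂, e₁ w₁ = e₂ w₂ →
      Submodule.map (mfderiv (𝓡∂ 4) (𝓡 4) e₁ w₁).toLinearMap (contactPlane J₁.J w₁) =
        Submodule.map (mfderiv (𝓡∂ 4) (𝓡 4) e₂ w₂).toLinearMap (contactPlane J₂.J w₂))
    (b₁ : BoundaryData (𝓡∂ 4) W₁ (𝓡 3)) (b₂ : BoundaryData (𝓡∂ 4) W₂ (𝓡 3))
    {ψ : b₁.carrier → b₂.carrier} (hψs : ContMDiff (𝓡 3) (𝓡 3) ∞ ψ)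
    (hψ : ∀ z, e₂ (b₂.incl (ψ z)) = e₁ (b₁.incl z)) : IsContacto J₁ J₂ b₁ b₂ ψ := by
  intro z v
  have hi₁ : MDifferentiableAt (𝓡 3) (𝓡∂ 4) b₁.incl z :=
    b₁.isSmoothEmbedding.contMDiff.mdifferentiableAt (by simp)
  have hi₂ψ : MDifferentiableAt (𝓡 3) (𝓡∂ 4) (b₂.incl ∘ ψ) z :=
    (b₂.isSmoothEmbedding.contMDiff.comp hψs).mdifferentiableAt (by simp)
  have he₁ : MDifferentiableAt (𝓡∂ 4) (𝓡 4) e₁ (b₁.incl z) :=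
    h₁.contMDiff.mdifferentiableAt (by simp)
  have he₂ : MDifferentiableAt (𝓡∂ 4) (𝓡 4) e₂ ((b₂.incl ∘ ψ) z) :=
    h₂.contMDiff.mdifferentiableAt (by simp)
  have hcomp : e₂ ∘ (b₂.incl ∘ ψ) = e₁ ∘ b₁.incl := funext hψ
  have key : mfderiv (𝓡∂ 4) (𝓡 4) e₂ (b₂.incl (ψ z)) (mfderiv (𝓡 3) (𝓡∂ 4) (b₂.incl ∘ ψ) z v) =
      mfderiv (𝓡∂ 4) (𝓡 4) e₁ (b₁.incl z) (mfderiv (𝓡 3) (𝓡∂ 4) b₁.incl z v) := by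
    rw [← mfderiv_comp_apply z he₁ hi₁ v, ← hcomp]
    exact (mfderiv_comp_apply z he₂ hi₂ψ v).symm
  have hM := hC (b₁.incl z) (b₂.incl (ψ z)) (hψ z).symm
  -- read everything on the model space `ℝ⁴`, pinning the types down
  set D₁ : EuclideanSpace ℝ (Fin 4) →L[ℝ] EuclideanSpace ℝ (Fin 4) :=
    mfderiv (𝓡∂ 4) (𝓡 4) e₁ (b₁.incl z)
  set D₂ : EuclideanSpace ℝ (Fin 4) →L[ℝ] EuclideanSpace ℝ (Fin 4) :=
    mfderiv (𝓡∂ 4) (𝓡 4) e₂ (b₂.incl (ψ z))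
  set a : EuclideanSpace ℝ (Fin 4) := mfderiv (𝓡 3) (𝓡∂ 4) b₁.incl z v
  set c : EuclideanSpace ℝ (Fin 4) := mfderiv (𝓡 3) (𝓡∂ 4) (b₂.incl ∘ ψ) z v
  have key' : D₂ c = D₁ a := key
  have hM' : Submodule.map (D₁ : EuclideanSpace ℝ (Fin 4) →ₗ[ℝ] EuclideanSpace ℝ (Fin 4))
        (contactPlane J₁.J (b₁.incl z)) =
      Submodule.map (D₂ : EuclideanSpace ℝ (Fin 4) →ₗ[ℝ] EuclideanSpace ℝ (Fin 4))
        (contactPlane J₂.J (b₂.incl (ψ z))) := hM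
  have hinj₁ : Injective D₁ :=
    Manifold.IsImmersionAt.mfderiv_injective (h₁.isImmersion.isImmersionAt _) (by simp)
  have hinj₂ : Injective D₂ :=
    Manifold.IsImmersionAt.mfderiv_injective (h₂.isImmersion.isImmersionAt _) (by simp)
  constructor
  · intro hv
    have hmem : D₂ c ∈ Submodule.map (D₁ : EuclideanSpace ℝ (Fin 4) →ₗ[ℝ] EuclideanSpace ℝ (Fin 4))
        (contactPlane J₁.J (b₁.incl z)) := by
      rw [hM']
      exact Submodule.mem_map.2 ⟨c, hv, rfl⟩
    obtain ⟨u, hu, hue⟩ := Submodule.mem_map.1 hmem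
    rw [ContinuousLinearMap.coe_coe, key'] at hue
    rw [← hinj₁ hue]
    exact hu
  · intro hv
    have hmem : D₁ a ∈ Submodule.map (D₂ : EuclideanSpace ℝ (Fin 4) →ₗ[ℝ] EuclideanSpace ℝ (Fin 4))
        (contactPlane J₂.J (b₂.incl (ψ z))) := by
      rw [← hM']
      exact Submodule.mem_map.2 ⟨a, hv, rfl⟩
    obtain ⟨u, hu, hue⟩ := Submodule.mem_map.1 hmem
    rw [ContinuousLinearMap.coe_coe, ← key'] at hue
    rw [← hinj₂ hue]
    exact hu

/-- **The seam map of a Stein bisection** (folklore; the Summits-side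
`LegendrianRKnotRigidity.stub_seam`, re-proved here because a Literature file cannot import it).
For two compact Stein domains smoothly embedded in a `4`-manifold `X` so that the images meet
exactly along the images of BOTH boundaries, with complex tangencies pushed forward to the same
planes at common points, and any boundary data `b₁`, `b₂`: the seam map
`ψ = incl₂⁻¹ ∘ e₂⁻¹ ∘ e₁ ∘ incl₁` is a diffeomorphism `b₁.carrier ≅ b₂.carrier` intertwining the
embeddings (`e₂ ∘ incl₂ ∘ ψ = e₁ ∘ incl₁`) and a contactomorphism (`IsContacto`).  Smoothness of
`ψ`, `ψ⁻¹` is the uniqueness of the smooth structure of the embedded submanifold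
`e₁(∂W₁) = e₂(∂W₂)` (Lee 2013, Thm. 5.29, Thm. 5.31); the contact property is the chain rule.
[cite: LeeSmoothManifolds2013, Thm. 5.29 and Thm. 5.31] -/
theorem exists_seamDiffeomorph_isContacto (J₁ : SteinStructure W₁) (J₂ : SteinStructure W₂)
    {e₁ : W₁ → X} {e₂ : W₂ → X}
    (h₁ : Manifold.IsSmoothEmbedding (𝓡∂ 4) (𝓡 4) ∞ e₁)
    (h₂ : Manifold.IsSmoothEmbedding (𝓡∂ 4) (𝓡 4) ∞ e₂)
    (hI₁ : range e₁ ∩ range e₂ = e₁ '' (𝓡∂ 4).boundary W₁)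
    (hI₂ : range e₁ ∩ range e₂ = e₂ '' (𝓡∂ 4).boundary W₂)
    (hC : ∀ w₁ w₂, e₁ w₁ = e₂ w₂ →
      Submodule.map (mfderiv (𝓡∂ 4) (𝓡 4) e₁ w₁).toLinearMap (contactPlane J₁.J w₁) =
        Submodule.map (mfderiv (𝓡∂ 4) (𝓡 4) e₂ w₂).toLinearMap (contactPlane J₂.J w₂))
    (b₁ : BoundaryData (𝓡∂ 4) W₁ (𝓡 3)) (b₂ : BoundaryData (𝓡∂ 4) W₂ (𝓡 3)) :
    ∃ ψ : b₁.carrier ≃ₘ⟮𝓡 3, 𝓡 3⟯ b₂.carrier,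
      (∀ z, e₂ (b₂.incl (ψ z)) = e₁ (b₁.incl z)) ∧ IsContacto J₁ J₂ b₁ b₂ ψ := by
  -- the seam map and its inverse, set-theoretically
  have hex₁ : ∀ z : b₁.carrier, ∃ w : b₂.carrier, e₂ (b₂.incl w) = e₁ (b₁.incl z) :=
    exists_incl_eq_of_seam hI₁ hI₂ b₁ b₂
  have hex₂ : ∀ w : b₂.carrier, ∃ z : b₁.carrier, e₁ (b₁.incl z) = e₂ (b₂.incl w) := by
    intro w
    have hI₁' : range e₂ ∩ range e₁ = e₂ '' (𝓡∂ 4).boundary W₂ := by rw [inter_comm]; exact hI₂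
    have hI₂' : range e₂ ∩ range e₁ = e₁ '' (𝓡∂ 4).boundary W₁ := by rw [inter_comm]; exact hI₁
    exact exists_incl_eq_of_seam hI₁' hI₂' b₂ b₁ w
  choose ψ hψ using hex₁
  choose φ hφ using hex₂
  have hinj₁ : Injective (e₁ ∘ b₁.incl) := h₁.isEmbedding.injective.comp b₁.injective_incl
  have hinj₂ : Injective (e₂ ∘ b₂.incl) := h₂.isEmbedding.injective.comp b₂.injective_incl
  have hleft : ∀ z, φ (ψ z) = z := fun z => hinj₁ (by
    show e₁ (b₁.incl (φ (ψ z))) = e₁ (b₁.incl z)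
    rw [hφ, hψ])
  have hright : ∀ w, ψ (φ w) = w := fun w => hinj₂ (by
    show e₂ (b₂.incl (ψ (φ w))) = e₂ (b₂.incl w)
    rw [hψ, hφ])
  -- smoothness of `ψ` and `φ` through the immersions `incl` and `e`
  have hψs : ContMDiff (𝓡 3) (𝓡 3) ∞ ψ :=
    contMDiff_of_comp_incl_eq h₂ b₂ (h₁.contMDiff.comp b₁.isSmoothEmbedding.contMDiff) hψ
  have hφs : ContMDiff (𝓡 3) (𝓡 3) ∞ φ :=
    contMDiff_of_comp_incl_eq h₁ b₁ (h₂.contMDiff.comp b₂.isSmoothEmbedding.contMDiff) hφ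
  let Ψ : b₁.carrier ≃ₘ⟮𝓡 3, 𝓡 3⟯ b₂.carrier :=
    { toFun := ψ
      invFun := φ
      left_inv := hleft
      right_inv := hright
      contMDiff_toFun := hψs
      contMDiff_invFun := hφs }
  exact ⟨Ψ, hψ, isContacto_of_seam J₁ J₂ h₁ h₂ hC b₁ b₂ hψs hψ⟩

omit [IsManifold (𝓡 4) ∞ X] [IsManifold (𝓡∂ 4) ∞ W₁] [CompactSpace W₁] [IsManifold (𝓡∂ 4) ∞ W₂]
  [CompactSpace W₂] in
/-- **A Stein bisection is a gluing along the seam map**: if the smoothly embedded halves cover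
`X` and meet exactly along `e₁(∂W₁)`, and `ψ : b₁.carrier → b₂.carrier` intertwines the
embeddings (`e₂ ∘ incl₂ ∘ ψ = e₁ ∘ incl₁`), then `X = W₁ ∪_ψ W₂` (`IsBoundaryGluing`): a common
point `e₁ x = e₂ y` lies on the seam, so `x = incl₁ z` by injectivity of `e₁`, and then
`e₂ y = e₂ (incl₂ (ψ z))` gives `y = incl₂ (ψ z)`.  Hirsch 1976, §8.2. [folklore] -/
theorem isBoundaryGluing_of_seam {e₁ : W₁ → X} {e₂ : W₂ → X}
    (h₁ : Manifold.IsSmoothEmbedding (𝓡∂ 4) (𝓡 4) ∞ e₁)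
    (h₂ : Manifold.IsSmoothEmbedding (𝓡∂ 4) (𝓡 4) ∞ e₂)
    (hU : range e₁ ∪ range e₂ = univ) (hI₁ : range e₁ ∩ range e₂ = e₁ '' (𝓡∂ 4).boundary W₁)
    (b₁ : BoundaryData (𝓡∂ 4) W₁ (𝓡 3)) (b₂ : BoundaryData (𝓡∂ 4) W₂ (𝓡 3))
    {ψ : b₁.carrier → b₂.carrier} (hψ : ∀ z, e₂ (b₂.incl (ψ z)) = e₁ (b₁.incl z)) :
    IsBoundaryGluing b₁ b₂ ψ (𝓡 4) X := by
  refine ⟨e₁, e₂, h₁, h₂, hU, fun x y => ⟨fun hxy => ?_, ?_⟩⟩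
  · have hmem : e₁ x ∈ range e₁ ∩ range e₂ := ⟨⟨x, rfl⟩, ⟨y, hxy.symm⟩⟩
    rw [hI₁] at hmem
    obtain ⟨x', hx', hx'e⟩ := hmem
    obtain rfl : x' = x := h₁.isEmbedding.injective hx'e
    rw [← b₁.range_incl] at hx'
    obtain ⟨z, rfl⟩ := hx'
    refine ⟨z, rfl, h₂.isEmbedding.injective ?_⟩
    rw [hψ, hxy]
  · rintro ⟨z, rfl, rfl⟩
    exact (hψ z).symm

end Contacto

end Literature.Geometry.Symplectic

end
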